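import Summits.Ventures.QEC.CircuitDistance.ETowerNodesX
import Summits.Ventures.QEC.CircuitDistance.ETowerTopsX
import Summits.Ventures.QEC.CircuitDistance.ETowerCountX
import Summits.Ventures.QEC.CircuitDistance.ETowerBase
import Summits.Ventures.QEC.CircuitDistance.PortK2InstBB144Final
import Summits.Ventures.QEC.CircuitDistance.ETowerZeroZ
import HarnessLib

/-!
# P3-PORT STEP 2 (E-fold tower), sector X: THE ASSEMBLY — from the unit / window / base-slice / zero-fibre facts to
# `K2_BB144_X` by plain `decide` (ASSEMBLY-SPEC §C; cell `qec`, experiment CDX, seat qec-cdx-type-1)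

`k2_bb144_X_of_tower`: the K2 list-completeness binder of record `K2_BB144_X` (PortBB144Value) from FOUR data inputs, each a
conjunction of `decide +kernel` facts emitted by eng-1 / idea-1 (no cube runs, no `native_decide`):
(U) units — `nodeA (bitsOf 45 0 t) = true` for every base numeral `t ∈ T3`;  (W) windows — `nodeCW L w = true` for the 4 × 8
weight-3 words/windows;  (B) base slices — `sliceCheck col3 3 3 5 9 T3 = true`, `Fibre.incr T3 = true`, orbit-size sums
`osum 3 3 5 w T3 = NW[w]` (w = 1..9);  (Z) zero fibres — the step-A zero-fibre property (from D-lists via `goodFibK_zero`,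
§B10) — here ALSO discharged from the six zero-fibre certificate facts (`zeroA_of_certsX`, via `ETowerZeroCert.zeroD_of_zcert`;
same shapes as sector Z's `ETowerZeroZ`).  Composition: `hW3_of_winsX` → `hkAX` (units as fibre properties) → `base_of_slices` + `card_Xw_X` → ★ `kc_of_tower` →
`binder_of_kc` (with `goodX144`, `hlogX144`, `hTOPS`, `hidx`) → the classes step of `k2_bb144_X`.
Nothing here asserts a value of `d_circ`; with the [[144]] Z twin and `bb144_circuitDistance_eq_ten` it yields the std word.
-/

set_option maxRecDepth 100000
set_option exponentiation.threshold 1024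

namespace Summit.Ventures.QEC.CircuitDistance.ETower.SecX

open Literature.InformationTheory.QuantumCodes Summit.Ventures.QEC.Census Summit.Ventures.QEC.Census.Fold
  Summit.Ventures.QEC.CircuitDistance.ETower Finset K2

/-- The KERNEL-COMPLETENESS statement of sector X: every kernel word of the record's syndrome table of weight `≤ 9` has all
logical parities zero or is a translate of a listed anchored class. -/
def KCX : Prop := ∀ u, u < 2 ^ nK GC 5 → kerK col0 (nK GC 5) u → popc (nK GC 5) u ≤ 9 → QT u

/-- ★ **THE TOWER GIVES `KCX`** from the four data inputs. -/
theorem kcX_of_data {T3 : List ℕ}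
    (hU : ∀ t ∈ T3, nodeA (bitsOf 45 0 t) = true)
    (hW : ∀ L ∈ W3L, ∀ w ∈ W3WIN3, nodeCW L w = true)
    (hBcheck : sliceCheck col3 3 3 5 9 T3 = true) (hBincr : Fibre.incr T3 = true)
    (hBsum : ∀ w, 1 ≤ w → w ≤ 9 → osum 3 3 5 w T3 = NW.getD w 0)
    (hZ : GoodFibK GA 5 col2 9 NB 0) : KCX := by
  have hW3 : ∀ r ∈ W3C, NC r := hW3_of_winsX hW
  -- units as fibre properties at the base numerals
  have hunits : ∀ t ∈ T3, GoodFibK GA 5 col2 9 NB t := by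
    intro t ht
    have hlt : t < 2 ^ (5 * (3 * 3)) := (of_sliceCheck hBcheck t ht).1
    have h := hkAX hW3 (bitsOf 45 0 t) (fun j hj => lt_of_lt_of_eq (lt_of_mem_bitsOf hj) (by decide)) (hU t ht)
    rwa [maskOf_bitsOf_zero _ _ hlt] at h
  -- base certificate
  have hbase : ∀ s, s < 2 ^ nsK GA 5 → kerK col3 (nsK GA 5) s → popc (nsK GA 5) s ≤ 9 → s = 0 ∨ MatchedK GA.ls GA.ms 5 T3 s := by
    have e : nsK GA 5 = 5 * (3 * 3) := by decide
    rw [e]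
    exact base_of_slices (ls := 3) (ms := 3) (by decide) (by decide) hK3 T3 hBcheck hBincr
      (fun w h1 hw => by rw [hBsum w h1 hw]; exact (card_Xw_X hw).symm)
  -- the composed tower
  exact kc_of_tower SecZ.shapeA SecZ.shapeB SecZ.shapeC SecZ.okA SecZ.okB SecZ.okC ⟨by decide, by decide⟩ ⟨by decide, by decide⟩ hRA hRB hRC hK2 hK1 hK0
    hQTX hbase hunits hZ

/-- ★ **`K2_BB144_X` FROM THE TOWER** (same statement as the binder of record; replaces the cube runs of `k2_bb144_X`). -/
theorem k2_bb144_X_of_kc (hKC : KCX) : K2_BB144_X := by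
  intro x hcls hnt hcard
  have hall := classesX144OK_true
  unfold classesX144OK at hall
  simp only [List.all_eq_true] at hall
  have hx : ∀ g ∈ x, g ∈ instX144.gsupp := by
    intro g hg
    obtain ⟨k, hk, i, hi⟩ := hcls g hg
    have h := hall k hk i (mem_monoList i)
    cases hck : bb144XTable.cls k with
    | none => rw [hck] at hi; exact absurd hi (by simp)
    | some g₀ =>
      rw [hck] at hi h
      simp only [Option.map_some, Option.some.injEq] at hi
      simp only [decide_eq_true_eq] at h
      rw [← hi]; exact h
  obtain ⟨wd, hwd, t, hxt⟩ := binder_of_kc (I := instX144) goodX144 hlogX144 (by decide) (by decide) (nb := 5) (W := 9)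
    (TOPS := TOPS) rfl (fun u hu hk hw => hKC u hu hk hw) hTOPS hidx x hx hnt.1 hnt.2 hcard
  obtain ⟨e, he, rfl⟩ := List.mem_map.1 hwd
  exact ⟨e, he, t, hxt⟩

/-- ★★ **`K2_BB144_X` from the four data inputs** (units, windows, base slices, step-A zero fibre). -/
theorem k2_bb144_X_of_data {T3 : List ℕ}
    (hU : ∀ t ∈ T3, nodeA (bitsOf 45 0 t) = true)
    (hW : ∀ L ∈ W3L, ∀ w ∈ W3WIN3, nodeCW L w = true)
    (hBcheck : sliceCheck col3 3 3 5 9 T3 = true) (hBincr : Fibre.incr T3 = true)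
    (hBsum : ∀ w, 1 ≤ w → w ≤ 9 → osum 3 3 5 w T3 = NW.getD w 0)
    (hZ : GoodFibK GA 5 col2 9 NB 0) : K2_BB144_X :=
  k2_bb144_X_of_kc (kcX_of_data hU hW hBcheck hBincr hBsum hZ)

/-! ## The step-A zero fibre from the brute-anchored certificates (§B10) -/

/-- ★ **THE STEP-A ZERO FIBRE of sector X from the certificates** (levels A, B, C: brute-anchored certificate over the fibre
table `tab TFA 24 / tab TFB 42 / tab TFC 72` with D-list `DA / DB / DC`, and the D-list node fact: every listed half-word's
double passes `nodeB / nodeC / ktop`). -/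
theorem zeroA_of_certsX (hW3 : ∀ r ∈ W3C, NC r) {DA DB DC : List ℕ}
    (hzA : ∀ b, b < 5 → ∀ k, k < 4 →
      zl k (tab TFA 24) (matchedB 3 3 5 DA) (tab TFA 24 (b * 9)) (2 ^ (b * 9)) (b * 9 + 1) 45 = true)
    (hdA : ∀ c ∈ DA, nodeB (bitsOf 90 0 (doubleK GA 5 c)) = true)
    (hzB : ∀ b, b < 5 → ∀ k, k < 4 →
      zl k (tab TFB 42) (matchedB 6 3 5 DB) (tab TFB 42 (b * 18)) (2 ^ (b * 18)) (b * 18 + 1) 90 = true)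
    (hdB : ∀ c ∈ DB, nodeC (bitsOf 180 0 (doubleK GB 5 c)) = true)
    (hzC : ∀ b, b < 5 → ∀ k, k < 4 →
      zl k (tab TFC 72) (matchedB 6 6 5 DC) (tab TFC 72 (b * 36)) (2 ^ (b * 36)) (b * 36 + 1) 180 = true)
    (hdC : ∀ c ∈ DC, ktop (bitsOf 360 0 (doubleK GC 5 c)) = true) :
    GoodFibK GA 5 col2 9 NB 0 := by
  -- level C
  have hC0 : NC 0 := by
    refine goodFibK_zero (G := GC) SecZ.shapeC SecZ.okC hK0 (Q := QT) hQTX qTop_zero DC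
      (zeroD_of_zcert (G := GC) (M := tab TFC 72) SecZ.shapeC SecZ.okC hMC hK0 (W := 9) (h := 4) (by norm_num) ?_) ?_
    · intro b hb k hk
      have e1 : GC.ls = 6 := by decide
      have e2 : GC.ms = 6 := by decide
      have e3 : nsK GC 5 = 180 := by decide
      rw [e1, e2, e3]; simp only [Nat.reduceMul]; exact hzC b hb k hk
    · intro c hc _
      exact goodQ_of_bits_doubleK (G := GC) SecZ.okC (by decide) (node := ktop) (fun S hS hl h => hktopX S hS hl h)
        (hdC c hc)
  -- level B
  have hB0 : NB 0 := by
    refine goodFibK_zero (G := GB) SecZ.shapeB SecZ.okB hK1 (Q := NC) hNCX hC0 DB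
      (zeroD_of_zcert (G := GB) (M := tab TFB 42) SecZ.shapeB SecZ.okB hMB hK1 (W := 9) (h := 4) (by norm_num) ?_) ?_
    · intro b hb k hk
      have e1 : GB.ls = 6 := by decide
      have e2 : GB.ms = 3 := by decide
      have e3 : nsK GB 5 = 90 := by decide
      rw [e1, e2, e3]; simp only [Nat.reduceMul]; exact hzB b hb k hk
    · intro c hc _
      exact goodQ_of_bits_doubleK (G := GB) SecZ.okB (by decide) (node := nodeC) (fun S hS _ h => hkCX hW3 S hS h)
        (hdB c hc)
  -- level A
  refine goodFibK_zero (G := GA) SecZ.shapeA SecZ.okA hK2 (Q := NB) hNBX hB0 DA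
    (zeroD_of_zcert (G := GA) (M := tab TFA 24) SecZ.shapeA SecZ.okA hMA hK2 (W := 9) (h := 4) (by norm_num) ?_) ?_
  · intro b hb k hk
    have e1 : GA.ls = 3 := by decide
    have e2 : GA.ms = 3 := by decide
    have e3 : nsK GA 5 = 45 := by decide
    rw [e1, e2, e3]; simp only [Nat.reduceMul]; exact hzA b hb k hk
  · intro c hc _
    exact goodQ_of_bits_doubleK (G := GA) SecZ.okA (by decide) (node := nodeB) (fun S hS _ h => hkBX hW3 S hS h)
      (hdA c hc)

/-- ★★ **`K2_BB144_X` from data only**: units, windows, base slices, and the six zero-fibre facts. -/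
theorem k2_bb144_X_of_certs {T3 DA DB DC : List ℕ}
    (hU : ∀ t ∈ T3, nodeA (bitsOf 45 0 t) = true)
    (hW : ∀ L ∈ W3L, ∀ w ∈ W3WIN3, nodeCW L w = true)
    (hBcheck : sliceCheck col3 3 3 5 9 T3 = true) (hBincr : Fibre.incr T3 = true)
    (hBsum : ∀ w, 1 ≤ w → w ≤ 9 → osum 3 3 5 w T3 = NW.getD w 0)
    (hzA : ∀ b, b < 5 → ∀ k, k < 4 →
      zl k (tab TFA 24) (matchedB 3 3 5 DA) (tab TFA 24 (b * 9)) (2 ^ (b * 9)) (b * 9 + 1) 45 = true)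
    (hdA : ∀ c ∈ DA, nodeB (bitsOf 90 0 (doubleK GA 5 c)) = true)
    (hzB : ∀ b, b < 5 → ∀ k, k < 4 →
      zl k (tab TFB 42) (matchedB 6 3 5 DB) (tab TFB 42 (b * 18)) (2 ^ (b * 18)) (b * 18 + 1) 90 = true)
    (hdB : ∀ c ∈ DB, nodeC (bitsOf 180 0 (doubleK GB 5 c)) = true)
    (hzC : ∀ b, b < 5 → ∀ k, k < 4 →
      zl k (tab TFC 72) (matchedB 6 6 5 DC) (tab TFC 72 (b * 36)) (2 ^ (b * 36)) (b * 36 + 1) 180 = true)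
    (hdC : ∀ c ∈ DC, ktop (bitsOf 360 0 (doubleK GC 5 c)) = true) : K2_BB144_X :=
  k2_bb144_X_of_data hU hW hBcheck hBincr hBsum (zeroA_of_certsX (hW3_of_winsX hW) hzA hdA hzB hdB hzC hdC)

end Summit.Ventures.QEC.CircuitDistance.ETower.SecX
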